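import Summits.CriticalPhenomena.PercolationContinuityZ3.Theorems.PercNearOneGluingNoHeavyConstsMDLXJointXEdge
import Literature.Probability.Percolation.TwoSetConditionalAssociation
import Literature.Probability.Percolation.TripodExchange
import HarnessLib

/-!
# The u = z CROSS member: cell form and the Y-SPLIT bound — the generic class is settled whenever `θ_L ≥ ν(Y | Z)`
# (PAPER-2 track (ii): constants of the CSH family; seat `prim-consts-2`, gen 24)

builds on p205010 (kernel theorem, internal audit signed; external expert review pending).  Support file (`--supports
stmt-CriticalPhenomena-4575`); memo `run/shared/lean/prim/consts/FROM-prim-consts-2-g24-CYLINDER-EVENTS.md` §0(4).  Theorems only; no definitions,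
no sorries, standard axioms.

SETTING.  `μ = prodBernoulli w`, owner `s`, markers `y, z`, avoided set `X`, `D = {s ↮ X}`, `Z = {s~z}`, `Y = {s~y}`; cells `c = μ(D∩Z∩Y)`,
`b_y′ = μ(D∩Z∩Yᶜ)`, `ζ = μ(D∩Z)`, `b = μ(D∩Zᶜ∩Y)`, `n = μ(D∩Zᶜ∩Yᶜ)`, `a_X = μ(y↮{s}∪X∪{z}, s↮X∪{z})`, `b_X = μ(y~z, y↮{s}∪X, s↮X)`;
`M₂(X)(F) = polMargin μ s y z F (X∪z)(X∪z) X + polMargin … (X∪z) X (X∪z) + polMargin … X (X∪z)(X∪z)` the u = z CROSS member.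
* `Consts.crossM2_eq_cells` — for every `F`: `M₂(X)(F) = a_X(b+n)·∫_{D∩Z}F − (a_Xζ + b_X n)·∫_{D∩Zᶜ∩Y}F − (a_Xζ − b_X b)·∫_{D∩Zᶜ∩Yᶜ}F`
  (the linear "Ψ-form" of the member; Strassen/pencil form of memo g23 §0(1)).
* `Consts.crossM2_ySplit` — **THEOREM (the Y-split bound).**  For every monotone 0/1-valued functional `F` of the open edge cluster and its
  PINNED part `F_Y(C) = F(C)·1{y ∈ V(C)}` (`= F · connIndicatorFn s y`):
  `n·M₂(X)(F) ≥ n·M₂(X)(F_Y) + [b_X·b·n − a_X·(c·n − b·b_y′)]·∫_{D∩Zᶜ∩Yᶜ}F`.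
  Mechanism: `M₂(F) − M₂(F_Y) = a_X(b+n)·∫_{D∩Z∩Yᶜ}F − (a_Xζ − b_X b)·∫_{D∩Zᶜ∩Yᶜ}F`, and the vdBHK conditional positive association of the
  increasing cluster events `{F(C_s)=1}`, `{s~z}` given `{s ↮ X ∪ {y}}` (Thm 1.2 with the avoided SET `X ∪ {y}`; tree:
  `BHK2006_setClusterConditionalPositiveAssociation`) gives `n·∫_{D∩Z∩Yᶜ}F ≥ b_y′·∫_{D∩Zᶜ∩Yᶜ}F`.  (`c·n − b·b_y′ = μ(D)²·Cov_ν(Y,Z) ≥ 0`.)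
* `Consts.crossM2_of_ySplit` — **COROLLARY: if `a_X·(c·n − b·b_y′) ≤ b_X·b·n` (equivalently `θ_L ≥ ν(Y|Z)` in the pencil parametrisation; ≈ 20–30 %
  of random placements, exact census) then `M₂(X)(F) ≥ M₂(X)(F_Y)`, so the pinned class (`Consts.crossRel_edge_M2_of_markerPinned`, taken as the
  hypothesis `0 ≤ M₂(X)(F_Y)`) gives `M₂(X)(F) ≥ 0` for EVERY monotone 0/1 functional** — the first PLACEMENT class on which the whole generic
  class of the u = z member is settled.  Exact checks: prim-consts-2/g24/eng/thmA_check.py (2 400 up-sets, |X| ≤ 2, 0 failures).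
[cite: VandenbergHaggstromKahn2005, Thm. 1.2 with Remark 1 (p. 5), Thm. 1.1 (pp. 3–5)] [cite: Grimmett1999, §2.2]
-/

noncomputable section

namespace Summit.CriticalPhenomena.PercolationContinuityZ3.Theorems

open MeasureTheory Set Literature.Probability.LatticeModels Literature.Probability.Percolation
open scoped Classical

namespace Consts

variable {V : Type*} [Fintype V]

/-- **Cell form of the u = z CROSS member.**  For `μ = prodBernoulli w` and every functional `F`:
`M₂(X)(F) = a_X·(b+n)·∫_{D∩Z}F − (a_X·ζ + b_X·n)·∫_{D∩Zᶜ∩Y}F − (a_X·ζ − b_X·b)·∫_{D∩Zᶜ∩Yᶜ}F`.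
[cite: VandenbergHaggstromKahn2005, Thm. 1.1 (pp. 3–5)] -/
theorem crossM2_eq_cells (w : Sym2 V → unitInterval) (s y z : V) (X : Set V) (F : Set (Sym2 V) → ℝ) :
    polMargin (prodBernoulli w) s y z F (insert z X) (insert z X) X + polMargin (prodBernoulli w) s y z F (insert z X) X (insert z X) +
        polMargin (prodBernoulli w) s y z F X (insert z X) (insert z X) =
      (prodBernoulli w).real ({ω : BondConfig V | ∀ x ∈ insert s (insert z X), ¬ (openGraph ω).Reachable y x} ∩
            {ω | ∀ x ∈ insert z X, ¬ (openGraph ω).Reachable s x}) *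
          ((prodBernoulli w).real ({ω : BondConfig V | ∀ x ∈ insert z X, ¬ (openGraph ω).Reachable s x} ∩ openConn s y) +
            (prodBernoulli w).real {ω : BondConfig V | (∀ x ∈ insert z X, ¬ (openGraph ω).Reachable s x) ∧ ¬ (openGraph ω).Reachable s y}) *
          (∫ ω in {ω : BondConfig V | ∀ x ∈ X, ¬ (openGraph ω).Reachable s x} ∩ openConn s z, F (openEdgeCluster ω s) ∂(prodBernoulli w)) -
        ((prodBernoulli w).real ({ω : BondConfig V | ∀ x ∈ insert s (insert z X), ¬ (openGraph ω).Reachable y x} ∩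
              {ω | ∀ x ∈ insert z X, ¬ (openGraph ω).Reachable s x}) *
            (prodBernoulli w).real ({ω : BondConfig V | ∀ x ∈ X, ¬ (openGraph ω).Reachable s x} ∩ openConn s z) +
          (prodBernoulli w).real ({ω : BondConfig V | ∀ x ∈ insert s X, ¬ (openGraph ω).Reachable y x} ∩
              {ω | ∀ x ∈ X, ¬ (openGraph ω).Reachable s x} ∩ openConn y z) *
            (prodBernoulli w).real {ω : BondConfig V | (∀ x ∈ insert z X, ¬ (openGraph ω).Reachable s x) ∧ ¬ (openGraph ω).Reachable s y}) *
          (∫ ω in {ω : BondConfig V | ∀ x ∈ insert z X, ¬ (openGraph ω).Reachable s x} ∩ openConn s y,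
            F (openEdgeCluster ω s) ∂(prodBernoulli w)) -
        ((prodBernoulli w).real ({ω : BondConfig V | ∀ x ∈ insert s (insert z X), ¬ (openGraph ω).Reachable y x} ∩
              {ω | ∀ x ∈ insert z X, ¬ (openGraph ω).Reachable s x}) *
            (prodBernoulli w).real ({ω : BondConfig V | ∀ x ∈ X, ¬ (openGraph ω).Reachable s x} ∩ openConn s z) -
          (prodBernoulli w).real ({ω : BondConfig V | ∀ x ∈ insert s X, ¬ (openGraph ω).Reachable y x} ∩
              {ω | ∀ x ∈ X, ¬ (openGraph ω).Reachable s x} ∩ openConn y z) *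
            (prodBernoulli w).real ({ω : BondConfig V | ∀ x ∈ insert z X, ¬ (openGraph ω).Reachable s x} ∩ openConn s y)) *
          (∫ ω in {ω : BondConfig V | (∀ x ∈ insert z X, ¬ (openGraph ω).Reachable s x) ∧ ¬ (openGraph ω).Reachable s y},
            F (openEdgeCluster ω s) ∂(prodBernoulli w)) := by
  set μ := prodBernoulli w with hμ
  set Dz : Set (BondConfig V) := {ω | ∀ x ∈ insert z X, ¬ (openGraph ω).Reachable s x} with hDz
  set N : Set (BondConfig V) := {ω | (∀ x ∈ insert z X, ¬ (openGraph ω).Reachable s x) ∧ ¬ (openGraph ω).Reachable s y} with hN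
  have hNeq : N = Dz \ openConn s y := by
    ext ω; simp only [hN, hDz, openConn, mem_setOf_eq, mem_sdiff]
  have hmDz : μ.real Dz = μ.real (Dz ∩ openConn s y) + μ.real N := by
    rw [hNeq]; exact (measureReal_inter_add_sdiff (μ := μ) (s := Dz) (MeasurableSet.of_discrete : MeasurableSet (openConn s y))).symm
  have hIDz : (∫ ω in Dz, F (openEdgeCluster ω s) ∂μ) =
      (∫ ω in Dz ∩ openConn s y, F (openEdgeCluster ω s) ∂μ) + ∫ ω in N, F (openEdgeCluster ω s) ∂μ := by
    rw [hNeq]; exact (integral_inter_add_sdiff (MeasurableSet.of_discrete : MeasurableSet (openConn s y)) Integrable.of_finite).symm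
  unfold polMargin
  have hW : ({ω : BondConfig V | ∀ x ∈ insert s (insert z X), ¬ (openGraph ω).Reachable y x} ∩ Dz ∩ openConn y z) = ∅ := by
    ext ω
    simp only [hDz, mem_inter_iff, mem_setOf_eq, forall_mem_insert, openConn, mem_empty_iff_false, iff_false]
    exact fun ⟨⟨⟨_, hyz, _⟩, _⟩, h⟩ => hyz h
  have hZ : (Dz ∩ openConn s z) = ∅ := by
    ext ω
    simp only [hDz, mem_inter_iff, mem_setOf_eq, forall_mem_insert, openConn, mem_empty_iff_false, iff_false]
    exact fun ⟨⟨hsz, _⟩, h⟩ => hsz h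
  simp only [← hDz] at hW hZ ⊢
  rw [hW, hZ, hIDz, hmDz]
  simp only [measureReal_empty, Measure.restrict_empty, integral_zero_measure]
  ring

/-- **The Y-split identity.**  For every functional `F`, with `F_Y = F·connIndicatorFn s y` (`F_Y(C_s) = F(C_s)·1{s~y}`):
`M₂(X)(F) = M₂(X)(F_Y) + a_X(b+n)·∫_{D∩Z∩Yᶜ}F − (a_Xζ − b_X b)·∫_{D∩Zᶜ∩Yᶜ}F`. [cite: VandenbergHaggstromKahn2005, Thm. 1.1 (pp. 3–5)] -/
theorem crossM2_ySplit_eq (w : Sym2 V → unitInterval) (s y z : V) (X : Set V) (F : Set (Sym2 V) → ℝ) :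
    polMargin (prodBernoulli w) s y z F (insert z X) (insert z X) X + polMargin (prodBernoulli w) s y z F (insert z X) X (insert z X) +
        polMargin (prodBernoulli w) s y z F X (insert z X) (insert z X) =
      (polMargin (prodBernoulli w) s y z (fun C => F C * connIndicatorFn s y C) (insert z X) (insert z X) X +
          polMargin (prodBernoulli w) s y z (fun C => F C * connIndicatorFn s y C) (insert z X) X (insert z X) +
          polMargin (prodBernoulli w) s y z (fun C => F C * connIndicatorFn s y C) X (insert z X) (insert z X)) +
        (prodBernoulli w).real ({ω : BondConfig V | ∀ x ∈ insert s (insert z X), ¬ (openGraph ω).Reachable y x} ∩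
              {ω | ∀ x ∈ insert z X, ¬ (openGraph ω).Reachable s x}) *
            ((prodBernoulli w).real ({ω : BondConfig V | ∀ x ∈ insert z X, ¬ (openGraph ω).Reachable s x} ∩ openConn s y) +
              (prodBernoulli w).real {ω : BondConfig V | (∀ x ∈ insert z X, ¬ (openGraph ω).Reachable s x) ∧ ¬ (openGraph ω).Reachable s y}) *
          (∫ ω in {ω : BondConfig V | (∀ x ∈ X, ¬ (openGraph ω).Reachable s x) ∧ (openGraph ω).Reachable s z ∧
              ¬ (openGraph ω).Reachable s y}, F (openEdgeCluster ω s) ∂(prodBernoulli w)) -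
        ((prodBernoulli w).real ({ω : BondConfig V | ∀ x ∈ insert s (insert z X), ¬ (openGraph ω).Reachable y x} ∩
                {ω | ∀ x ∈ insert z X, ¬ (openGraph ω).Reachable s x}) *
              (prodBernoulli w).real ({ω : BondConfig V | ∀ x ∈ X, ¬ (openGraph ω).Reachable s x} ∩ openConn s z) -
            (prodBernoulli w).real ({ω : BondConfig V | ∀ x ∈ insert s X, ¬ (openGraph ω).Reachable y x} ∩
                {ω | ∀ x ∈ X, ¬ (openGraph ω).Reachable s x} ∩ openConn y z) *
              (prodBernoulli w).real ({ω : BondConfig V | ∀ x ∈ insert z X, ¬ (openGraph ω).Reachable s x} ∩ openConn s y)) *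
          (∫ ω in {ω : BondConfig V | (∀ x ∈ insert z X, ¬ (openGraph ω).Reachable s x) ∧ ¬ (openGraph ω).Reachable s y},
            F (openEdgeCluster ω s) ∂(prodBernoulli w)) := by
  set μ := prodBernoulli w with hμ
  set D : Set (BondConfig V) := {ω | ∀ x ∈ X, ¬ (openGraph ω).Reachable s x} with hD
  set Dz : Set (BondConfig V) := {ω | ∀ x ∈ insert z X, ¬ (openGraph ω).Reachable s x} with hDz
  set N : Set (BondConfig V) := {ω | (∀ x ∈ insert z X, ¬ (openGraph ω).Reachable s x) ∧ ¬ (openGraph ω).Reachable s y} with hN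
  set M : Set (BondConfig V) := {ω | (∀ x ∈ X, ¬ (openGraph ω).Reachable s x) ∧ (openGraph ω).Reachable s z ∧
    ¬ (openGraph ω).Reachable s y} with hM
  have hY : MeasurableSet (openConn s y : Set (BondConfig V)) := MeasurableSet.of_discrete
  have hFY : ∀ ω : BondConfig V, F (openEdgeCluster ω s) * connIndicatorFn s y (openEdgeCluster ω s) =
      (openConn s y).indicator (fun ω => F (openEdgeCluster ω s)) ω := by
    intro ω
    rw [connIndicatorFn_openEdgeCluster]
    by_cases h : ω ∈ openConn s y
    · rw [indicator_of_mem h, indicator_of_mem h, Pi.one_apply, mul_one]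
    · rw [indicator_of_notMem h, indicator_of_notMem h, mul_zero]
  have hMeq : M = (D ∩ openConn s z) \ openConn s y := by
    ext ω; simp only [hM, hD, openConn, mem_sdiff, mem_inter_iff, mem_setOf_eq, and_assoc]
  have hNz : Dz ∩ openConn s y ∩ openConn s y = Dz ∩ openConn s y := by rw [inter_assoc, inter_self]
  have hNY : N ∩ openConn s y = ∅ := by
    ext ω; simp only [hN, openConn, mem_inter_iff, mem_setOf_eq, mem_empty_iff_false, iff_false]; exact fun ⟨⟨_, h⟩, h'⟩ => h h'
  have iZ : (∫ ω in D ∩ openConn s z, (openConn s y).indicator (fun ω => F (openEdgeCluster ω s)) ω ∂μ) =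
      ∫ ω in D ∩ openConn s z ∩ openConn s y, F (openEdgeCluster ω s) ∂μ := setIntegral_indicator hY
  have iY : (∫ ω in Dz ∩ openConn s y, (openConn s y).indicator (fun ω => F (openEdgeCluster ω s)) ω ∂μ) =
      ∫ ω in Dz ∩ openConn s y, F (openEdgeCluster ω s) ∂μ := by rw [setIntegral_indicator hY, hNz]
  have iN : (∫ ω in N, (openConn s y).indicator (fun ω => F (openEdgeCluster ω s)) ω ∂μ) = 0 := by
    rw [setIntegral_indicator hY, hNY, Measure.restrict_empty, integral_zero_measure]
  have iZsplit : (∫ ω in D ∩ openConn s z, F (openEdgeCluster ω s) ∂μ) =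
      (∫ ω in D ∩ openConn s z ∩ openConn s y, F (openEdgeCluster ω s) ∂μ) + ∫ ω in M, F (openEdgeCluster ω s) ∂μ := by
    rw [hMeq]; exact (integral_inter_add_sdiff hY Integrable.of_finite).symm
  have eF := crossM2_eq_cells w s y z X F
  have eFY := crossM2_eq_cells w s y z X (fun C => F C * connIndicatorFn s y C)
  simp only [hFY] at eFY
  simp only [← hμ, ← hD, ← hDz, ← hN] at eF eFY ⊢
  rw [iZ, iY, iN] at eFY
  rw [eF, eFY, iZsplit]
  ring

/-- **vdBHK conditional positive association of `{F(C_s)}` and `{s~z}` given `{s ↮ X ∪ {y}}`** (Thm 1.2 with the avoided SET `X ∪ {y}`),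
in cell form: `μ(D∩Z∩Yᶜ)·∫_{D∩Zᶜ∩Yᶜ}F ≤ μ(D∩Zᶜ∩Yᶜ)·∫_{D∩Z∩Yᶜ}F` for every monotone `F`.
[cite: VandenbergHaggstromKahn2005, Thm. 1.2 with Remark 1 (p. 5)] -/
theorem crossM2_ySplit_cpa (w : Sym2 V → unitInterval) (s y z : V) (X : Set V) (F : Set (Sym2 V) → ℝ) (hFm : Monotone F) :
    (prodBernoulli w).real {ω : BondConfig V | (∀ x ∈ X, ¬ (openGraph ω).Reachable s x) ∧ (openGraph ω).Reachable s z ∧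
          ¬ (openGraph ω).Reachable s y} *
        (∫ ω in {ω : BondConfig V | (∀ x ∈ insert z X, ¬ (openGraph ω).Reachable s x) ∧ ¬ (openGraph ω).Reachable s y},
          F (openEdgeCluster ω s) ∂(prodBernoulli w)) ≤
      (prodBernoulli w).real {ω : BondConfig V | (∀ x ∈ insert z X, ¬ (openGraph ω).Reachable s x) ∧ ¬ (openGraph ω).Reachable s y} *
        (∫ ω in {ω : BondConfig V | (∀ x ∈ X, ¬ (openGraph ω).Reachable s x) ∧ (openGraph ω).Reachable s z ∧
          ¬ (openGraph ω).Reachable s y}, F (openEdgeCluster ω s) ∂(prodBernoulli w)) := by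
  set μ := prodBernoulli w with hμ
  set N : Set (BondConfig V) := {ω | (∀ x ∈ insert z X, ¬ (openGraph ω).Reachable s x) ∧ ¬ (openGraph ω).Reachable s y} with hN
  set M : Set (BondConfig V) := {ω | (∀ x ∈ X, ¬ (openGraph ω).Reachable s x) ∧ (openGraph ω).Reachable s z ∧
    ¬ (openGraph ω).Reachable s y} with hM
  set DYc : Set (BondConfig V) := {ω | ∀ t ∈ insert y X, ¬ (openGraph ω).Reachable s t} with hDYc
  have hZm : MeasurableSet (openConn s z : Set (BondConfig V)) := MeasurableSet.of_discrete
  have hDYc_eq : DYc = N ∪ M := by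
    ext ω
    simp only [hDYc, hN, hM, forall_mem_insert, mem_union, mem_setOf_eq]
    constructor
    · rintro ⟨hy, hX⟩
      by_cases hz : (openGraph ω).Reachable s z
      · exact Or.inr ⟨hX, hz, hy⟩
      · exact Or.inl ⟨⟨hz, hX⟩, hy⟩
    · rintro (⟨⟨hz, hX⟩, hy⟩ | ⟨hX, hz, hy⟩) <;> exact ⟨hy, hX⟩
  have hNM : Disjoint N M := by
    rw [Set.disjoint_iff]
    rintro ω ⟨⟨hzX, _⟩, ⟨_, hz', _⟩⟩
    exact hzX z (mem_insert z X) hz'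
  have hDYcZ : DYc ∩ openConn s z = M := by
    ext ω
    simp only [hDYc, hM, openConn, forall_mem_insert, mem_inter_iff, mem_setOf_eq]
    tauto
  have hcpa := BHK2006_setClusterConditionalPositiveAssociation w ({s} : Set V) (insert y X) F (connIndicatorFn s z) hFm
    (monotone_connIndicatorFn s z)
  have hDYc' : {ω : BondConfig V | ∀ s' ∈ ({s} : Set V), ∀ t ∈ insert y X, ¬ (openGraph ω).Reachable s' t} = DYc := by
    ext ω; simp only [hDYc, mem_setOf_eq, mem_singleton_iff, forall_eq]
  simp only [hDYc', biUnion_singleton, connIndicatorFn_openEdgeCluster] at hcpa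
  have j1 : (∫ ω in DYc, (openConn s z).indicator (1 : BondConfig V → ℝ) ω ∂μ) = μ.real M := by
    rw [TripodExchange.setIntegral_indicator_one_eq w DYc (openConn s z), hDYcZ]
  have j2 : (∫ ω in DYc, F (openEdgeCluster ω s) * (openConn s z).indicator (1 : BondConfig V → ℝ) ω ∂μ) =
      ∫ ω in M, F (openEdgeCluster ω s) ∂μ := by
    have h1 : ∀ ω, F (openEdgeCluster ω s) * (openConn s z).indicator (1 : BondConfig V → ℝ) ω =
        (openConn s z).indicator (fun ω => F (openEdgeCluster ω s)) ω := by
      intro ω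
      by_cases h : ω ∈ openConn s z
      · rw [indicator_of_mem h, indicator_of_mem h, Pi.one_apply, mul_one]
      · rw [indicator_of_notMem h, indicator_of_notMem h, mul_zero]
    simp only [h1]
    rw [setIntegral_indicator hZm, hDYcZ]
  have j3 : (∫ ω in DYc, F (openEdgeCluster ω s) ∂μ) = (∫ ω in N, F (openEdgeCluster ω s) ∂μ) + ∫ ω in M, F (openEdgeCluster ω s) ∂μ := by
    rw [hDYc_eq]; exact setIntegral_union hNM MeasurableSet.of_discrete Integrable.of_finite Integrable.of_finite
  have j4 : μ.real DYc = μ.real N + μ.real M := by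
    rw [hDYc_eq]; exact measureReal_union hNM MeasurableSet.of_discrete
  simp only [← hμ] at hcpa
  rw [j1, j2, j3, j4] at hcpa
  linarith [hcpa]

/-- **THE Y-SPLIT BOUND.**  For `μ = prodBernoulli w`, all `s, y, z, X` and every monotone functional `F` of the open edge cluster, with
`F_Y = F · connIndicatorFn s y` (the pinned part `F·1{y ∈ V(C)}`):
`n·M₂(X)(F) ≥ n·M₂(X)(F_Y) + [b_X·b·n − a_X·(c·n − b·b_y′)]·∫_{D∩Zᶜ∩Yᶜ} F`
(`n = μ(D∩Zᶜ∩Yᶜ)`, `b = μ(D∩Zᶜ∩Y)`, `c = μ(D∩Z∩Y)`, `b_y′ = μ(D∩Z∩Yᶜ)`). [cite: VandenbergHaggstromKahn2005, Thm. 1.2 with Remark 1 (p. 5)] -/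
theorem crossM2_ySplit (w : Sym2 V → unitInterval) (s y z : V) (X : Set V) (F : Set (Sym2 V) → ℝ) (hFm : Monotone F) :
    (prodBernoulli w).real {ω : BondConfig V | (∀ x ∈ insert z X, ¬ (openGraph ω).Reachable s x) ∧ ¬ (openGraph ω).Reachable s y} *
        (polMargin (prodBernoulli w) s y z F (insert z X) (insert z X) X +
            polMargin (prodBernoulli w) s y z F (insert z X) X (insert z X) +
          polMargin (prodBernoulli w) s y z F X (insert z X) (insert z X)) ≥
      (prodBernoulli w).real {ω : BondConfig V | (∀ x ∈ insert z X, ¬ (openGraph ω).Reachable s x) ∧ ¬ (openGraph ω).Reachable s y} *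
          (polMargin (prodBernoulli w) s y z (fun C => F C * connIndicatorFn s y C) (insert z X) (insert z X) X +
              polMargin (prodBernoulli w) s y z (fun C => F C * connIndicatorFn s y C) (insert z X) X (insert z X) +
            polMargin (prodBernoulli w) s y z (fun C => F C * connIndicatorFn s y C) X (insert z X) (insert z X)) +
        ((prodBernoulli w).real ({ω : BondConfig V | ∀ x ∈ insert s X, ¬ (openGraph ω).Reachable y x} ∩
                {ω | ∀ x ∈ X, ¬ (openGraph ω).Reachable s x} ∩ openConn y z) *
              (prodBernoulli w).real ({ω : BondConfig V | ∀ x ∈ insert z X, ¬ (openGraph ω).Reachable s x} ∩ openConn s y) *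
            (prodBernoulli w).real {ω : BondConfig V | (∀ x ∈ insert z X, ¬ (openGraph ω).Reachable s x) ∧ ¬ (openGraph ω).Reachable s y} -
          (prodBernoulli w).real ({ω : BondConfig V | ∀ x ∈ insert s (insert z X), ¬ (openGraph ω).Reachable y x} ∩
                {ω | ∀ x ∈ insert z X, ¬ (openGraph ω).Reachable s x}) *
            ((prodBernoulli w).real ({ω : BondConfig V | ∀ x ∈ X, ¬ (openGraph ω).Reachable s x} ∩ openConn s z ∩ openConn s y) *
                (prodBernoulli w).real {ω : BondConfig V | (∀ x ∈ insert z X, ¬ (openGraph ω).Reachable s x) ∧ ¬ (openGraph ω).Reachable s y} -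
              (prodBernoulli w).real ({ω : BondConfig V | ∀ x ∈ insert z X, ¬ (openGraph ω).Reachable s x} ∩ openConn s y) *
                (prodBernoulli w).real {ω : BondConfig V | (∀ x ∈ X, ¬ (openGraph ω).Reachable s x) ∧ (openGraph ω).Reachable s z ∧
                  ¬ (openGraph ω).Reachable s y})) *
          (∫ ω in {ω : BondConfig V | (∀ x ∈ insert z X, ¬ (openGraph ω).Reachable s x) ∧ ¬ (openGraph ω).Reachable s y},
            F (openEdgeCluster ω s) ∂(prodBernoulli w)) := by
  have e := crossM2_ySplit_eq w s y z X F
  have hcpa := crossM2_ySplit_cpa w s y z X F hFm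
  have hY : MeasurableSet (openConn s y : Set (BondConfig V)) := MeasurableSet.of_discrete
  have hζsplit : (prodBernoulli w).real ({ω : BondConfig V | ∀ x ∈ X, ¬ (openGraph ω).Reachable s x} ∩ openConn s z) =
      (prodBernoulli w).real ({ω : BondConfig V | ∀ x ∈ X, ¬ (openGraph ω).Reachable s x} ∩ openConn s z ∩ openConn s y) +
      (prodBernoulli w).real {ω : BondConfig V | (∀ x ∈ X, ¬ (openGraph ω).Reachable s x) ∧ (openGraph ω).Reachable s z ∧
        ¬ (openGraph ω).Reachable s y} := by
    rw [show {ω : BondConfig V | (∀ x ∈ X, ¬ (openGraph ω).Reachable s x) ∧ (openGraph ω).Reachable s z ∧ ¬ (openGraph ω).Reachable s y} =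
        ({ω : BondConfig V | ∀ x ∈ X, ¬ (openGraph ω).Reachable s x} ∩ openConn s z) \ openConn s y by
      ext ω; simp only [openConn, mem_sdiff, mem_inter_iff, mem_setOf_eq, and_assoc]]
    exact (measureReal_inter_add_sdiff (μ := prodBernoulli w)
      (s := {ω : BondConfig V | ∀ x ∈ X, ¬ (openGraph ω).Reachable s x} ∩ openConn s z) hY).symm
  rw [e, hζsplit]
  have haX0 : 0 ≤ (prodBernoulli w).real ({ω : BondConfig V | ∀ x ∈ insert s (insert z X), ¬ (openGraph ω).Reachable y x} ∩
      {ω | ∀ x ∈ insert z X, ¬ (openGraph ω).Reachable s x}) := measureReal_nonneg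
  have hb0 : 0 ≤ (prodBernoulli w).real ({ω : BondConfig V | ∀ x ∈ insert z X, ¬ (openGraph ω).Reachable s x} ∩ openConn s y) :=
    measureReal_nonneg
  have hn0 : 0 ≤ (prodBernoulli w).real {ω : BondConfig V | (∀ x ∈ insert z X, ¬ (openGraph ω).Reachable s x) ∧
      ¬ (openGraph ω).Reachable s y} := measureReal_nonneg
  -- abstract the atoms and finish linearly
  generalize (prodBernoulli w).real ({ω : BondConfig V | ∀ x ∈ insert s (insert z X), ¬ (openGraph ω).Reachable y x} ∩
      {ω | ∀ x ∈ insert z X, ¬ (openGraph ω).Reachable s x}) = aX at *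
  generalize (prodBernoulli w).real ({ω : BondConfig V | ∀ x ∈ insert s X, ¬ (openGraph ω).Reachable y x} ∩
      {ω | ∀ x ∈ X, ¬ (openGraph ω).Reachable s x} ∩ openConn y z) = bX at *
  generalize hn : (prodBernoulli w).real {ω : BondConfig V | (∀ x ∈ insert z X, ¬ (openGraph ω).Reachable s x) ∧
      ¬ (openGraph ω).Reachable s y} = nn at *
  generalize hb : (prodBernoulli w).real ({ω : BondConfig V | ∀ x ∈ insert z X, ¬ (openGraph ω).Reachable s x} ∩ openConn s y) = b at *
  generalize hby : (prodBernoulli w).real {ω : BondConfig V | (∀ x ∈ X, ¬ (openGraph ω).Reachable s x) ∧ (openGraph ω).Reachable s z ∧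
      ¬ (openGraph ω).Reachable s y} = by' at *
  generalize (prodBernoulli w).real ({ω : BondConfig V | ∀ x ∈ X, ¬ (openGraph ω).Reachable s x} ∩ openConn s z ∩ openConn s y) = c at *
  generalize (∫ ω in {ω : BondConfig V | (∀ x ∈ insert z X, ¬ (openGraph ω).Reachable s x) ∧ ¬ (openGraph ω).Reachable s y},
      F (openEdgeCluster ω s) ∂(prodBernoulli w)) = JN at *
  generalize (∫ ω in {ω : BondConfig V | (∀ x ∈ X, ¬ (openGraph ω).Reachable s x) ∧ (openGraph ω).Reachable s z ∧
      ¬ (openGraph ω).Reachable s y}, F (openEdgeCluster ω s) ∂(prodBernoulli w)) = JM at *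
  generalize (polMargin (prodBernoulli w) s y z (fun C => F C * connIndicatorFn s y C) (insert z X) (insert z X) X +
      polMargin (prodBernoulli w) s y z (fun C => F C * connIndicatorFn s y C) (insert z X) X (insert z X) +
      polMargin (prodBernoulli w) s y z (fun C => F C * connIndicatorFn s y C) X (insert z X) (insert z X)) = MY at *
  have hα : 0 ≤ aX * (b + nn) := mul_nonneg haX0 (add_nonneg hb0 hn0)
  have hkey := mul_le_mul_of_nonneg_left hcpa hα
  nlinarith [hkey]

/-- **COROLLARY: the generic class of the u = z CROSS member on the placements with `a_X·(c·n − b·b_y′) ≤ b_X·b·n`** (equivalently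
`θ_L ≥ ν(Y|Z)`; ≈ 20–30 % of random placements).  If the pinned functional `F_Y = F·connIndicatorFn s y` has `M₂(X)(F_Y) ≥ 0` (the pinned
class, `Consts.crossRel_edge_M2_of_markerPinned`), then `M₂(X)(F) ≥ 0` for the monotone nonnegative functional `F`.
[cite: VandenbergHaggstromKahn2005, Thm. 1.2 with Remark 1 (p. 5), Thm. 1.1 (pp. 3–5)] -/
theorem crossM2_of_ySplit (w : Sym2 V → unitInterval) (s y z : V) (X : Set V) (F : Set (Sym2 V) → ℝ) (hFm : Monotone F)
    (hF0 : ∀ C, 0 ≤ F C)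
    (hcond : (prodBernoulli w).real ({ω : BondConfig V | ∀ x ∈ insert s (insert z X), ¬ (openGraph ω).Reachable y x} ∩
          {ω | ∀ x ∈ insert z X, ¬ (openGraph ω).Reachable s x}) *
        ((prodBernoulli w).real ({ω : BondConfig V | ∀ x ∈ X, ¬ (openGraph ω).Reachable s x} ∩ openConn s z ∩ openConn s y) *
            (prodBernoulli w).real {ω : BondConfig V | (∀ x ∈ insert z X, ¬ (openGraph ω).Reachable s x) ∧ ¬ (openGraph ω).Reachable s y} -
          (prodBernoulli w).real ({ω : BondConfig V | ∀ x ∈ insert z X, ¬ (openGraph ω).Reachable s x} ∩ openConn s y) *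
            (prodBernoulli w).real {ω : BondConfig V | (∀ x ∈ X, ¬ (openGraph ω).Reachable s x) ∧ (openGraph ω).Reachable s z ∧
              ¬ (openGraph ω).Reachable s y}) ≤
      (prodBernoulli w).real ({ω : BondConfig V | ∀ x ∈ insert s X, ¬ (openGraph ω).Reachable y x} ∩
            {ω | ∀ x ∈ X, ¬ (openGraph ω).Reachable s x} ∩ openConn y z) *
          (prodBernoulli w).real ({ω : BondConfig V | ∀ x ∈ insert z X, ¬ (openGraph ω).Reachable s x} ∩ openConn s y) *
        (prodBernoulli w).real {ω : BondConfig V | (∀ x ∈ insert z X, ¬ (openGraph ω).Reachable s x) ∧ ¬ (openGraph ω).Reachable s y})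
    (hpinY : 0 ≤ polMargin (prodBernoulli w) s y z (fun C => F C * connIndicatorFn s y C) (insert z X) (insert z X) X +
            polMargin (prodBernoulli w) s y z (fun C => F C * connIndicatorFn s y C) (insert z X) X (insert z X) +
          polMargin (prodBernoulli w) s y z (fun C => F C * connIndicatorFn s y C) X (insert z X) (insert z X)) :
    0 ≤ polMargin (prodBernoulli w) s y z F (insert z X) (insert z X) X +
          polMargin (prodBernoulli w) s y z F (insert z X) X (insert z X) +
        polMargin (prodBernoulli w) s y z F X (insert z X) (insert z X) := by
  have hA := crossM2_ySplit w s y z X F hFm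
  have e := crossM2_ySplit_eq w s y z X F
  have hJN0 : 0 ≤ (∫ ω in {ω : BondConfig V | (∀ x ∈ insert z X, ¬ (openGraph ω).Reachable s x) ∧ ¬ (openGraph ω).Reachable s y},
      F (openEdgeCluster ω s) ∂(prodBernoulli w)) := setIntegral_nonneg MeasurableSet.of_discrete fun ω _ => hF0 _
  have hJM0 : 0 ≤ (∫ ω in {ω : BondConfig V | (∀ x ∈ X, ¬ (openGraph ω).Reachable s x) ∧ (openGraph ω).Reachable s z ∧
      ¬ (openGraph ω).Reachable s y}, F (openEdgeCluster ω s) ∂(prodBernoulli w)) := setIntegral_nonneg MeasurableSet.of_discrete fun ω _ => hF0 _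
  by_cases hn : (prodBernoulli w).real {ω : BondConfig V | (∀ x ∈ insert z X, ¬ (openGraph ω).Reachable s x) ∧ ¬ (openGraph ω).Reachable s y} = 0
  · -- `n = 0`: the last integral vanishes and `M₂(F) = M₂(F_Y) + a_X·b·∫_{D∩Z∩Yᶜ}F ≥ 0`
    have hJ : (∫ ω in {ω : BondConfig V | (∀ x ∈ insert z X, ¬ (openGraph ω).Reachable s x) ∧ ¬ (openGraph ω).Reachable s y},
        F (openEdgeCluster ω s) ∂(prodBernoulli w)) = 0 := by
      have h0 : (prodBernoulli w) {ω : BondConfig V | (∀ x ∈ insert z X, ¬ (openGraph ω).Reachable s x) ∧ ¬ (openGraph ω).Reachable s y} = 0 :=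
        (measureReal_eq_zero_iff (measure_ne_top _ _)).1 hn
      rw [Measure.restrict_eq_zero.2 h0, integral_zero_measure]
    rw [e, hJ, hn]
    have hα : 0 ≤ (prodBernoulli w).real ({ω : BondConfig V | ∀ x ∈ insert s (insert z X), ¬ (openGraph ω).Reachable y x} ∩
        {ω | ∀ x ∈ insert z X, ¬ (openGraph ω).Reachable s x}) *
        ((prodBernoulli w).real ({ω : BondConfig V | ∀ x ∈ insert z X, ¬ (openGraph ω).Reachable s x} ∩ openConn s y) + 0) :=
      mul_nonneg measureReal_nonneg (by rw [add_zero]; exact measureReal_nonneg)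
    nlinarith [mul_nonneg hα hJM0, hpinY]
  · have hnpos : 0 < (prodBernoulli w).real {ω : BondConfig V | (∀ x ∈ insert z X, ¬ (openGraph ω).Reachable s x) ∧
        ¬ (openGraph ω).Reachable s y} := lt_of_le_of_ne measureReal_nonneg (Ne.symm hn)
    have h3 := mul_le_mul_of_nonneg_right hcond hJN0
    have h2 : 0 ≤ (prodBernoulli w).real {ω : BondConfig V | (∀ x ∈ insert z X, ¬ (openGraph ω).Reachable s x) ∧
        ¬ (openGraph ω).Reachable s y} * (polMargin (prodBernoulli w) s y z F (insert z X) (insert z X) X +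
          polMargin (prodBernoulli w) s y z F (insert z X) X (insert z X) +
        polMargin (prodBernoulli w) s y z F X (insert z X) (insert z X)) := by
      nlinarith [hA, mul_nonneg (le_of_lt hnpos) hpinY, h3]
    exact (mul_nonneg_iff_of_pos_left hnpos).1 h2

end Consts

end Summit.CriticalPhenomena.PercolationContinuityZ3.Theorems

end
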